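import Summits.QuantumAdvantage.QuantumAdvantage.Theorems.CubicForrelationNearExactIsExactTwelveLevelFiveGenericAt2932

/-!
# Crux `CubicForrelation.NearExactIsExact` (stmt-QuantumAdvantage-14043) — n = 12 AT `Φ = 29/32`: a type-O side whose partner is a GENERIC
  level-5 side has base set `768` or `896` (so the bases `512`, `992`, `1024` only admit RIGID level-5 partners)

Certificate seat `b2b-cforr-cert` (gen 22).  HONEST FRAMING: a kernel-checked repackaging (standard axioms, no `decide`) of
`tw22_levelFive_generic_partner_base` (…TwelveLevelFiveGenericAt2932) from the type-O side's point of view, for the bookkeeping of the boundary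
rung `29/32` at `n = 12` (HOME/b2b-cforr-cert-g22/PLAN-N12-928-EQ.md): together with …TwelveTypeO1024At2932 (partner not type O),
…TwelveTypeO992At2932 / …TwelveTypeO992LevelSixAt2932 (partner neither type O nor level `≥ 6`) and …TwelveTypeO960LevelSixAt2932 (base `960` dead)
it leaves, for the bases `992` and `1024`, only partners that are RIGID level-5 sides (round-1 configuration of …TwelveLevelFiveRoundOneGe2932, or
off-hyperplane energy exactly `1024`) resp. level `≥ 6` (base `1024`).  NO new value of `θ₁₂`.  NOT summit progress.

* `to22_typeO_genericLevelFive_partner_base`: cubic `f, g`, `W_g = 16u` with some `u` odd, `Φ ≥ 29/32`, and the partner `f` a generic level-5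
  side (`W_f = 32u'_f`, some `u'_f` odd, `u'_f = 2(−1)^g` off its odd set, `8 ∣ u'_f − 2(−1)^g − (−1)^D` on it for a quadratic `D`): then
  `#E_g ∈ {768, 896}`.
* `to22_typeO_E992_genericLevelFive_partner_false`, `to22_typeO_E1024_genericLevelFive_partner_false`,
  `to22_typeO_E512_genericLevelFive_partner_false`: the bases `992`, `1024`, `512` admit no generic level-5 partner.

References: J. Ax (1964) / R. J. McEliece (1972); Kasami–Tokura (1970); MacWilliams–Sloane (1977) Ch. 13–15.  Axioms: the standard three.
-/

set_option linter.dupNamespace false -- D-0017: single-problem summit ⇒ `QuantumAdvantage.QuantumAdvantage` by design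

noncomputable section

namespace Summit.QuantumAdvantage.QuantumAdvantage.Theorems.CubicForrelation.NearExactIsExact

open Finset
open Literature.Computability.QuantumComplexity
open Literature.Computability.QuantumComplexity.DerivativeWalsh (W)

/-- **A type-O side with a generic level-5 partner has base `768` or `896`** (12 bits, `Φ ≥ 29/32`).  See the module docstring.  NOT summit
progress. [this work] -/
theorem to22_typeO_genericLevelFive_partner_base (f g : (Fin (6 + 6) → Bool) → Bool) (hf : IsDegLeFun 3 f) (hg : IsDegLeFun 3 g)
    (u : (Fin (6 + 6) → Bool) → ℤ) (hu : ∀ x, W (fun y => signOf (g y)) x = (2 : ℝ) ^ 4 * (u x : ℝ))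
    (hΦ : (29 / 32 : ℝ) ≤ forrelation f g)
    (uf' : (Fin (6 + 6) → Bool) → ℤ) (huf' : ∀ y, W (fun x => signOf (f x)) y = (2 : ℝ) ^ 5 * (uf' y : ℝ)) (hoddf : ∃ y, Odd (uf' y))
    (hofff : ∀ y, ¬ Odd (uf' y) → uf' y = 2 * sZ (g y))
    (D : (Fin (6 + 6) → Bool) → Bool) (hD : IsDegLeFun 2 D) (h8 : ∀ y, Odd (uf' y) → (8 : ℤ) ∣ uf' y - 2 * sZ (g y) - sZ (D y)) :
    #(univ.filter fun x : Fin (6 + 6) → Bool => (Odd (u x / 2) ↔ Odd (u x / 2 / 2))) = 768 ∨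
      #(univ.filter fun x : Fin (6 + 6) → Bool => (Odd (u x / 2) ↔ Odd (u x / 2 / 2))) = 896 := by
  have hΦ' : forrelation g f = forrelation f g := by
    rw [Summit.QuantumAdvantage.QuantumAdvantage.Theorems.SignedCubicForrelationNotPrBPP.Negative.HalfQuad.forrelation_comm]
  obtain ⟨ug, hug, -, hbase⟩ :=
    tw22_levelFive_generic_partner_base g f hg hf uf' huf' hoddf (by rw [hΦ']; exact hΦ) hofff D hD h8
  have heq : ∀ x, ug x = u x := by
    intro x
    have h := (hug x).symm.trans (hu x)
    have h2 : (2 : ℝ) ^ 4 ≠ 0 := by norm_num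
    have h' : ((ug x : ℤ) : ℝ) = ((u x : ℤ) : ℝ) := mul_left_cancel₀ h2 h
    exact_mod_cast h'
  have hset : (univ.filter fun x : Fin (6 + 6) → Bool => (Odd (ug x / 2) ↔ Odd (ug x / 2 / 2))) =
      univ.filter fun x : Fin (6 + 6) → Bool => (Odd (u x / 2) ↔ Odd (u x / 2 / 2)) :=
    filter_congr fun x _ => by rw [heq x]
  rw [hset] at hbase
  exact hbase

/-- **Base `992` admits no generic level-5 partner** at `Φ ≥ 29/32` (12 bits).  NOT summit progress. [this work] -/
theorem to22_typeO_E992_genericLevelFive_partner_false (f g : (Fin (6 + 6) → Bool) → Bool) (hf : IsDegLeFun 3 f) (hg : IsDegLeFun 3 g)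
    (u : (Fin (6 + 6) → Bool) → ℤ) (hu : ∀ x, W (fun y => signOf (g y)) x = (2 : ℝ) ^ 4 * (u x : ℝ))
    (hE : #(univ.filter fun x : Fin (6 + 6) → Bool => (Odd (u x / 2) ↔ Odd (u x / 2 / 2))) = 992)
    (hΦ : (29 / 32 : ℝ) ≤ forrelation f g)
    (uf' : (Fin (6 + 6) → Bool) → ℤ) (huf' : ∀ y, W (fun x => signOf (f x)) y = (2 : ℝ) ^ 5 * (uf' y : ℝ)) (hoddf : ∃ y, Odd (uf' y))
    (hofff : ∀ y, ¬ Odd (uf' y) → uf' y = 2 * sZ (g y))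
    (D : (Fin (6 + 6) → Bool) → Bool) (hD : IsDegLeFun 2 D) (h8 : ∀ y, Odd (uf' y) → (8 : ℤ) ∣ uf' y - 2 * sZ (g y) - sZ (D y)) :
    False := by
  rcases to22_typeO_genericLevelFive_partner_base f g hf hg u hu hΦ uf' huf' hoddf hofff D hD h8 with h | h <;> rw [hE] at h <;>
    norm_num at h

/-- **Base `1024` admits no generic level-5 partner** at `Φ ≥ 29/32` (12 bits).  NOT summit progress. [this work] -/
theorem to22_typeO_E1024_genericLevelFive_partner_false (f g : (Fin (6 + 6) → Bool) → Bool) (hf : IsDegLeFun 3 f) (hg : IsDegLeFun 3 g)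
    (u : (Fin (6 + 6) → Bool) → ℤ) (hu : ∀ x, W (fun y => signOf (g y)) x = (2 : ℝ) ^ 4 * (u x : ℝ))
    (hE : #(univ.filter fun x : Fin (6 + 6) → Bool => (Odd (u x / 2) ↔ Odd (u x / 2 / 2))) = 1024)
    (hΦ : (29 / 32 : ℝ) ≤ forrelation f g)
    (uf' : (Fin (6 + 6) → Bool) → ℤ) (huf' : ∀ y, W (fun x => signOf (f x)) y = (2 : ℝ) ^ 5 * (uf' y : ℝ)) (hoddf : ∃ y, Odd (uf' y))
    (hofff : ∀ y, ¬ Odd (uf' y) → uf' y = 2 * sZ (g y))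
    (D : (Fin (6 + 6) → Bool) → Bool) (hD : IsDegLeFun 2 D) (h8 : ∀ y, Odd (uf' y) → (8 : ℤ) ∣ uf' y - 2 * sZ (g y) - sZ (D y)) :
    False := by
  rcases to22_typeO_genericLevelFive_partner_base f g hf hg u hu hΦ uf' huf' hoddf hofff D hD h8 with h | h <;> rw [hE] at h <;>
    norm_num at h

/-- **Base `512` admits no generic level-5 partner** at `Φ ≥ 29/32` (12 bits).  NOT summit progress. [this work] -/
theorem to22_typeO_E512_genericLevelFive_partner_false (f g : (Fin (6 + 6) → Bool) → Bool) (hf : IsDegLeFun 3 f) (hg : IsDegLeFun 3 g)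
    (u : (Fin (6 + 6) → Bool) → ℤ) (hu : ∀ x, W (fun y => signOf (g y)) x = (2 : ℝ) ^ 4 * (u x : ℝ))
    (hE : #(univ.filter fun x : Fin (6 + 6) → Bool => (Odd (u x / 2) ↔ Odd (u x / 2 / 2))) = 512)
    (hΦ : (29 / 32 : ℝ) ≤ forrelation f g)
    (uf' : (Fin (6 + 6) → Bool) → ℤ) (huf' : ∀ y, W (fun x => signOf (f x)) y = (2 : ℝ) ^ 5 * (uf' y : ℝ)) (hoddf : ∃ y, Odd (uf' y))
    (hofff : ∀ y, ¬ Odd (uf' y) → uf' y = 2 * sZ (g y))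
    (D : (Fin (6 + 6) → Bool) → Bool) (hD : IsDegLeFun 2 D) (h8 : ∀ y, Odd (uf' y) → (8 : ℤ) ∣ uf' y - 2 * sZ (g y) - sZ (D y)) :
    False := by
  rcases to22_typeO_genericLevelFive_partner_base f g hf hg u hu hΦ uf' huf' hoddf hofff D hD h8 with h | h <;> rw [hE] at h <;>
    norm_num at h

end Summit.QuantumAdvantage.QuantumAdvantage.Theorems.CubicForrelation.NearExactIsExact

end
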